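import Literature.Computability.FineGrained.CliqueETHWordRAMBridge
import HarnessLib

/-!
# Sparse `k`-SAT on the word RAM: the liberal form from the strict form

Support for the named fact `Literature.Computability.FineGrained.kSATInRAMTime_of_sparseKSATInRAMTime`
(`CliqueETH.lean`; Impagliazzo–Paturi–Zane, JCSS 63 (2001), Cor. 1–2 read on the word RAM). The
tree proves that fact through multi-stack Turing machines (`CliqueETHMachineModel`,
`CliqueETHTMBridge`, `SETHHardnessProofs`), whose entrance
`sparseKSATInExpTime_of_liberalSparseKSATInRAMTime_holds` wants the *liberal* form
`LiberalSparseKSATInRAMTime k c δ` (every clause list of width `≤ k` with `≤ c n` clauses,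
repetitions allowed, every word size from `k'' · (n + inputWidth x)` on), whereas the hypothesis of
the fact is the strict `SparseKSATInRAMTime k c δ` (`List.Nodup` instances of `kSATProblem k`, word
size exactly `k' · (n + inputWidth x)`). The verified deduplication wrapper
(`DedupWrap.Params.wrapper_outputsWithin`, `CliqueETHDedupProgram.lean`) with its word-size and
time analysis (`ETHBridge.fits`, `ETHBridge.Tpre_le`, `CliqueETHWordRAMBridge.lean`, where the same
wrapper turns a full `k`-SAT decider into a liberal one) closes the gap; this file adds what is
specific to the *sparse* hypothesis:

* `DedupWrap.kM_pos_sparse` — a word-size constant `k' = 0` is contradictory already for a decider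
  of the sparse instances of density `≥ 2` (`k ≥ 1`): `x₀` (satisfiable) and `x₀ ∧ ¬x₀`
  (unsatisfiable) are `Nodup` width-`1` instances on one variable with at most two clauses, and at
  word size `0` a program answers both in the same way (`ETHBridge.outputsWithin_zero_of`,
  `outputsWithin_unique_holds`; the instance `[[]]` of `ETHBridge.kM_pos` is not sparse);
* **`DedupWrap.liberalSparseKSATInRAMTime_of_sparseKSATInRAMTime_max`** —
  `SparseKSATInRAMTime k (max c 2) δ → LiberalSparseKSATInRAMTime k c δ` for `k ≥ 1`, `δ > 0`: the
  deduplicated clause list is a `Nodup` instance with the same `numVars`, input width and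
  satisfiability and at most as many clauses (`DedupWrap.numClauses_dedup_le`), so density `c` is
  kept; the `∀ c`-form `DedupWrap.liberalSparseKSATInRAMTime_of_sparseKSATInRAMTime` is the
  hypothesis-to-entrance step of `kSATInRAMTime_of_sparseKSATInRAMTime_holds` (`CliqueETHProofs.lean`).

## References

* R. Impagliazzo, R. Paturi, F. Zane, *Which problems have strongly exponential complexity?*,
  JCSS 63 (2001) 512–530, §2: Thm. 1, Cor. 1 (sparsification), Cor. 2 (`k`-SAT with parameter
  `n` SERF-reduces to `k`-SAT with parameter `m`).
* V. Vassilevska Williams, *On some fine-grained questions in algorithms and complexity*,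
  Proc. ICM 2018, §2 (the word RAM; robustness of the hypotheses under the machine model).
-/

namespace Literature.Computability.FineGrained

open Cryptography Cryptography.WordRAM Complexity Cryptography.WordRAM.SProg

namespace DedupWrap

/-! ### Two sparse instances that a word-size-`0` program cannot tell apart -/

/-- The formula `x₀`. [folklore] -/
def φ₁ : CNF ℕ := [[(0, true)]]

/-- The formula `x₀ ∧ ¬x₀`. [folklore] -/
def φ₂ : CNF ℕ := [[(0, true)], [(0, false)]]

/-- `x₀` is satisfiable. [folklore] -/
theorem φ₁_sat : CNF.Satisfiable φ₁ := ⟨fun _ => true, by decide⟩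

/-- `x₀ ∧ ¬x₀` is unsatisfiable. [folklore] -/
theorem φ₂_unsat : ¬ CNF.Satisfiable φ₂ := by
  rintro ⟨σ, hσ⟩
  unfold φ₂ CNF.eval at hσ
  cases h : σ 0 <;> simp [Literal.eval, h] at hσ

/-- **A word-size constant `0` is contradictory for a decider of the sparse instances** of density
`c ≥ 2` of `kSATProblem k`, `k ≥ 1`: `x₀` and `x₀ ∧ ¬x₀` are such instances (one variable, at most
two clauses, width `1`, no repeated clause) with different accepted answers, while at word size
`0` the run does not depend on the input. [folklore] -/
theorem kM_pos_sparse {k c : ℕ} (hk : 1 ≤ k) (hc : 2 ≤ c) {M : Program}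
    {T : (kSATProblem k).Inst → ℕ}
    (hM : ∀ φ : (kSATProblem k).Inst, CNF.numClauses φ.1 ≤ c * (kSATProblem k).size φ →
      ∃ out ∈ (kSATProblem k).Good φ,
        OutputsWithin M (0 * ((kSATProblem k).size φ + (kSATProblem k).width φ)) noOracle
          zeroCoins ((kSATProblem k).encode φ) out (T φ)) : False := by
  have hw1 : CNF.IsWidthLE k φ₁ := fun cl hcl => by
    simp only [φ₁, List.mem_singleton] at hcl; subst hcl; simpa using hk
  have hw2 : CNF.IsWidthLE k φ₂ := fun cl hcl => by
    simp only [φ₂, List.mem_cons, List.not_mem_nil, or_false] at hcl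
    rcases hcl with rfl | rfl <;> simpa using hk
  let ψ₁ : (kSATProblem k).Inst := ⟨φ₁, hw1, by decide⟩
  let ψ₂ : (kSATProblem k).Inst := ⟨φ₂, hw2, by decide⟩
  obtain ⟨out₁, hout₁, h₁⟩ := hM ψ₁ (by show (1 : ℕ) ≤ c * 1; omega)
  obtain ⟨out₂, hout₂, h₂⟩ := hM ψ₂ (by show (2 : ℕ) ≤ c * 1; omega)
  have e₁ : out₁ = [1] := by
    have : out₁ ∈ CNFSAT.Good φ₁ := hout₁
    rw [CNFSAT_good_iff, if_pos φ₁_sat] at this; exact this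
  have e₂ : out₂ = [0] := by
    have : out₂ ∈ CNFSAT.Good φ₂ := hout₂
    rw [CNFSAT_good_iff, if_neg φ₂_unsat] at this; exact this
  rw [zero_mul] at h₁ h₂
  have := outputsWithin_unique_holds
    (ETHBridge.outputsWithin_zero_of h₁ ((kSATProblem k).encode ψ₂)) h₂
  rw [e₁, e₂] at this
  simp at this

/-! ### The liberal form from the sparse form -/

open scoped Classical in
/-- **Sparse `k`-SAT on the word RAM, liberal form from the strict form.** For `k ≥ 1` and
`δ > 0`, a deterministic word-RAM decider of the `List.Nodup` instances of `kSATProblem k` with at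
most `max c 2 · n` clauses, run at word size exactly `k' · (n + inputWidth x)` within
`⌊C 2^{δ n} + C⌋₊` steps (`SparseKSATInRAMTime k (max c 2) δ`), yields a decider of every clause
list of width `≤ k` with at most `c · n` clauses, repetitions allowed, at every word size
`W ≥ (k' + cM + 12) · (n + inputWidth x)`, within `⌊C' 2^{δ n} + C'⌋₊` steps
(`LiberalSparseKSATInRAMTime k c δ`): the wrapper `DedupWrap.wrapper M k'` deduplicates the clause
list (the result is a `Nodup` instance with the same `numVars`, input width and satisfiability and
no more clauses, hence of density `≤ c ≤ max c 2`; cubic time, `ETHBridge.Tpre_le`, absorbed by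
`2^{δ n}`) and emulates `M` at its own word size (`DedupWrap.Params.wrapper_outputsWithin`,
`ETHBridge.fits`); `k' = 0` is contradictory (`kM_pos_sparse`, which is where density `2` and
`k ≥ 1` are used). [folklore] -/
theorem liberalSparseKSATInRAMTime_of_sparseKSATInRAMTime_max {k c : ℕ} {δ : ℝ} (hk : 1 ≤ k)
    (hδ : 0 < δ) (h : SparseKSATInRAMTime k (max c 2) δ) : LiberalSparseKSATInRAMTime k c δ := by
  obtain ⟨M, kM, C, hdet, hof, hM⟩ := h
  rcases Nat.eq_zero_or_pos kM with rfl | hkM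
  · exact (kM_pos_sparse hk (le_max_right c 2) hM).elim
  obtain ⟨C₃, hC₃0, hC₃⟩ := exists_pow_le_two_rpow 3 hδ
  set C' : ℝ := max C 0 with hC'
  have hC'0 : 0 ≤ C' := le_max_right _ _
  set B : ℕ := (c * c * (12 * (c * (k + 1) + 2) + 14) + c * (10 * (c * (k + 1) + 2) + 20) +
    11 * (c * (k + 1) + 2) + 144) with hB
  set A : ℝ := (B : ℝ) * C₃ + 76 * C' with hA
  have hA0 : 0 ≤ A := by positivity
  refine ⟨wrapper M kM, kM + M.maxConst + 12, A, wrapper_isDeterministic M kM,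
    wrapper_isOracleFree M kM, fun φ hw hsparse W hW => ?_⟩
  -- the ghost parameters of this run
  set g : Params := ⟨φ, kM, M.maxConst⟩ with hgdef
  have hx : encodeCNFWords φ = g.x := rfl
  have hn : CNF.numVars φ = g.n := rfl
  rw [hx, hn] at hW ⊢
  have hF : g.Fits W := ETHBridge.fits_mono (ETHBridge.fits g) hW
  have hcg : g.m ≤ c * g.n := hsparse
  have hwg : g.φ.IsWidthLE k := hw
  -- the decider on the deduplicated instance, which is sparse of density `c`
  let φd : (kSATProblem k).Inst := ⟨φ.dedup, isWidthLE_dedup hw, List.nodup_dedup φ⟩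
  have hsz : (kSATProblem k).size φd = g.n := numVars_dedup φ
  have hsp : CNF.numClauses φd.1 ≤ max c 2 * (kSATProblem k).size φd := by
    rw [hsz]
    exact (numClauses_dedup_le φ).trans (hcg.trans (Nat.mul_le_mul_right _ (le_max_left _ _)))
  obtain ⟨out, hout, hrun⟩ := hM φd hsp
  have hws : kM * ((kSATProblem k).size φd + (kSATProblem k).width φd) = g.ws := g.ws_eq.symm
  have henc : (kSATProblem k).encode φd = g.y := rfl
  have hgood : out = [if φ.Satisfiable then 1 else 0] := by
    have : out ∈ CNFSAT.Good φ.dedup := hout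
    rw [CNFSAT_good_iff] at this
    rw [this]
    by_cases hs : φ.Satisfiable
    · rw [if_pos hs, if_pos ((satisfiable_dedup_iff φ).2 hs)]
    · rw [if_neg hs, if_neg (mt (satisfiable_dedup_iff φ).1 hs)]
  rw [hws, henc, hgood, hsz] at hrun
  have hred := g.wrapper_outputsWithin hF hkM hdet hof rfl hrun
  refine ⟨_, (CNFSAT_good_iff φ _).2 rfl, hred.mono ?_⟩
  -- the time bound
  set n := g.n
  have hT := ETHBridge.Tpre_le g hwg hcg
  apply Nat.le_floor
  have hpos : (0 : ℝ) < (2 : ℝ) ^ (δ * n) := by positivity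
  have hone : (1 : ℝ) ≤ (2 : ℝ) ^ (δ * n) := Real.one_le_rpow (by norm_num) (by positivity)
  have hfl : ((⌊C * (2 : ℝ) ^ (δ * (n : ℝ)) + C⌋₊ : ℕ) : ℝ) ≤ C' * (2 : ℝ) ^ (δ * n) + C' := by
    have h1 : C * (2 : ℝ) ^ (δ * (n : ℝ)) + C ≤ C' * (2 : ℝ) ^ (δ * n) + C' :=
      add_le_add (mul_le_mul_of_nonneg_right (le_max_left _ _) hpos.le) (le_max_left _ _)
    exact (Nat.cast_le.2 (Nat.floor_le_floor h1)).trans (Nat.floor_le (by positivity))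
  have hTr : ((g.Tpre + 4 : ℕ) : ℝ) ≤ (B : ℝ) * C₃ * (2 : ℝ) ^ (δ * n) := by
    have h1 : ((g.Tpre + 4 : ℕ) : ℝ) ≤ ((B * (n + 1) ^ 3 : ℕ) : ℝ) := by exact_mod_cast hT
    have h2 : ((B * (n + 1) ^ 3 : ℕ) : ℝ) = (B : ℝ) * ((n : ℝ) + 1) ^ 3 := by
      push_cast; ring
    rw [h2] at h1
    calc ((g.Tpre + 4 : ℕ) : ℝ) ≤ (B : ℝ) * ((n : ℝ) + 1) ^ 3 := h1
      _ ≤ (B : ℝ) * (C₃ * (2 : ℝ) ^ (δ * n)) :=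
          mul_le_mul_of_nonneg_left (hC₃ n) (Nat.cast_nonneg _)
      _ = _ := by ring
  unfold Params.Ttotal
  push_cast
  have hcs : (cstep : ℝ) = 38 := by norm_num [cstep]
  rw [hcs]
  have e : ((g.Tpre : ℕ) : ℝ) + 38 * ((⌊C * (2 : ℝ) ^ (δ * (n : ℝ)) + C⌋₊ : ℕ) : ℝ) + 4 =
      ((g.Tpre + 4 : ℕ) : ℝ) + 38 * ((⌊C * (2 : ℝ) ^ (δ * (n : ℝ)) + C⌋₊ : ℕ) : ℝ) := by
    push_cast; ring
  rw [e]
  calc ((g.Tpre + 4 : ℕ) : ℝ) + 38 * ((⌊C * (2 : ℝ) ^ (δ * (n : ℝ)) + C⌋₊ : ℕ) : ℝ)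
      ≤ (B : ℝ) * C₃ * (2 : ℝ) ^ (δ * n) + 38 * (C' * (2 : ℝ) ^ (δ * n) + C') := by
        gcongr
    _ ≤ (B : ℝ) * C₃ * (2 : ℝ) ^ (δ * n) +
          38 * (C' * (2 : ℝ) ^ (δ * n) + C' * (2 : ℝ) ^ (δ * n)) := by
        have h38 : C' ≤ C' * (2 : ℝ) ^ (δ * n) := le_mul_of_one_le_right hC'0 hone
        linarith
    _ = A * (2 : ℝ) ^ (δ * n) := by rw [hA]; ring
    _ ≤ A * (2 : ℝ) ^ (δ * n) + A := by linarith

/-- **The `∀ c`-form**: word-RAM deciders of sparse `k`-SAT of every density and every `δ > 0`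
(`SparseKSATInRAMTime`) give liberal deciders of every density and every `δ > 0`
(`LiberalSparseKSATInRAMTime`), for `k ≥ 1` — the hypothesis of
`kSATInRAMTime_of_sparseKSATInRAMTime` turned into the entrance of the Turing-machine route
(`sparseKSATInExpTime_of_liberalSparseKSATInRAMTime_holds`). [folklore] -/
theorem liberalSparseKSATInRAMTime_of_sparseKSATInRAMTime {k : ℕ} (hk : 1 ≤ k)
    (h : ∀ (c : ℕ) (δ : ℝ), 0 < δ → SparseKSATInRAMTime k c δ) (c : ℕ) (δ : ℝ) (hδ : 0 < δ) :
    LiberalSparseKSATInRAMTime k c δ :=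
  liberalSparseKSATInRAMTime_of_sparseKSATInRAMTime_max hk hδ (h (max c 2) δ hδ)

end DedupWrap

end Literature.Computability.FineGrained
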